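import Literature.NumberTheory.Automorphic.GL2CESHHecke
import Literature.NumberTheory.Automorphic.GL2CuspFormArchUnipotentVanishing
import Literature.NumberTheory.Automorphic.GL2CCoeffModelEquiv
import Literature.NumberTheory.Automorphic.ClozelAlgebraicityCMAssemblyProofs
import Literature.NumberTheory.Automorphic.AdelicGroupDataAutomorphicMeasureProofs
import HarnessLib

/-!
# The Eichler–Shimura–Harder eigenclass of a clean Bianchi cusp form: assembly

For `K` imaginary quadratic, a clean cuspidal `π = W / 0` of `GL₂(𝔸_K)` of cohomological infinity
type for the dominant weights `λ_τ` (the `a`-exponents of its type are those of the cohomological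
type of `λ_τ^∨`), a level `𝔫 ≠ 0` and a non-zero `K(𝔫)`-fixed form of `W`, we assemble the
family data `GL2CESH.FamilyData` (`GL2CESHFamilyDeriv`) — Lie action and Harish-Chandra scalars of
the centre (`scalars_of_hasHCParameter`), the coordinate model `Θ` of `E_λ(ℂ)`
(`GL2CCoeff.exists_coeffModelEquiv`), the lowest `K`-type in the level (`exists_lowestKType_mem_of_noinv`,
cusp forms have no archimedean unipotent invariants), the closed and co-closed cochain
`η` of the model (`eshCochain_model`) — together with a unitary twist `|det|^{κ/4}` of `π`
(`κ` the central exponent of `E_λ(ℂ)`; the exponent of `A_G` on `W` is `−κ`,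
`HasInfinityType.apply_posRealScalar_mul_of_W'_eq_bot`), and conclude with
`GL2CESHNonvanishing.vanEstClass_ne_zero` and `GL2CESHHecke.heckeT_vanEstClass`:
**there is a non-zero class in `H¹(S_{K_f(𝔫)}, E_λ(ℂ))` on which `T_{v,i}`, `v ∤ 𝔫`, act by the
Satake scalars of `π`** (`cleanResGLTwo_eigenclass`) — the hypothesis `h2c` of
`bianchi_cuspidal_regularLAlgebraic_eigenclassExists_of_cleanResGLTwo'`.
[cite: Harder1987, §3] [cite: Scholze2015, §V.4, proof of Cor. V.4.2] [cite: BorelWallach2000, VII §2]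

Theorems only; no named fact.
-/

noncomputable section

-- Mathlib idiom (Mathlib/Algebra/Lie/OfAssociative.lean), as in `GL2CCuspFormOps`.
attribute [local instance 100] LieRing.ofAssociativeRing

open scoped Matrix ComplexConjugate MatrixGroups Topology BigOperators NNReal
open Complex Finset
open _root_.MeasureTheory

namespace Literature.NumberTheory.Automorphic

namespace GL2CESH

open scoped Classical
open _root_.NumberField _root_.NumberField.InfinitePlace _root_.NumberField.mixedEmbedding IsDedekindDomain
open RealMatrixGroup ComplexPlace ImaginaryQuadratic GL2CCoeff GL2CAut GL2CKType GL2CCuspForm GL2C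
open AutomorphicRepData GLnComplexCasimir GL2ComplexCasimir HCWt GL2CESHMat Matrix ResGLnCohomology GLnCohomology
open Literature.NumberTheory.DiophantineGeometry Literature.NumberTheory.GaloisRepresentations Literature.Barriers.Langlands

variable {K : Type} [Field K] [NumberField K]

attribute [local instance] FamilyData.completeSpace_coeffModule

/-! ### Arithmetic of the central exponent -/

/-- For dominant weights, `κ = ∑_τ (λ_{τ,0} + λ_{τ,1})`. [folklore] -/
theorem centralExp_eq_sum {lam : (K →+* ℂ) → Fin 2 → ℤ} (hdom : ∀ τ, Weight.IsDominant (lam τ)) :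
    FamilyData.centralExp lam = ∑ τ, (lam τ 0 + lam τ 1) := by
  unfold FamilyData.centralExp
  refine Finset.sum_congr rfl fun τ _ => ?_
  rw [lowestEntry_two, coeffDegree_two_cast (lam τ) (hdom τ)]
  ring

/-- `∑ {a, b} = a + b` for a two-element multiset. [folklore] -/
theorem multiset_sum_pair (a b : ℂ) : ({a, b} : Multiset ℂ).sum = a + b := by
  rw [Multiset.insert_eq_cons, Multiset.sum_cons, Multiset.sum_singleton]

/-- The `A_G`-exponent of a clean `π` of cohomological type for `λ^∨`: `∑_σ ∑ a(T σ) = −κ`. [folklore] -/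
theorem sum_sum_a_eq_neg_centralExp {lam : (K →+* ℂ) → Fin 2 → ℤ} (hdom : ∀ τ, Weight.IsDominant (lam τ))
    {T : InfinityType K 2}
    (hTa : ∀ τ : K →+* ℂ, (T τ).map ArchWeight.a = (cohomologicalInfinityType 2 K (Weight.dual (lam τ)) τ).map ArchWeight.a) :
    (∑ σ : K →+* ℂ, ((T σ).map ArchWeight.a).sum) = -(FamilyData.centralExp lam : ℂ) := by
  rw [centralExp_eq_sum hdom, Int.cast_sum, ← Finset.sum_neg_distrib]
  refine Finset.sum_congr rfl fun σ _ => ?_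
  rw [hTa σ, cohomological_map_a, multiset_sum_pair]
  push_cast
  ring

/-- `(t⁴)^{κ/4} = t^κ` for `t > 0`. [folklore] -/
theorem ofReal_pow_four_cpow {t : ℝ} (ht : 0 < t) (κ : ℤ) :
    (((t ^ (2 * 2) : ℝ)) : ℂ) ^ ((κ : ℂ) / 4) = ((t : ℂ)) ^ κ := by
  have h4 : t ^ (2 * 2) = t ^ ((4 : ℕ) : ℝ) := by rw [Real.rpow_natCast]
  have hexp : ((κ : ℂ) / 4) = (((κ : ℝ) / 4 : ℝ) : ℂ) := by push_cast; ring
  rw [hexp, ← Complex.ofReal_cpow (by positivity), h4, ← Real.rpow_mul ht.le]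
  have : ((4 : ℕ) : ℝ) * ((κ : ℝ) / 4) = ((κ : ℤ) : ℝ) := by push_cast; ring
  rw [this, Real.rpow_intCast, Complex.ofReal_zpow]

/-! ### The unitary twist `|det|^{κ/4}` -/

/-- **A clean cuspidal `π` of cohomological type has the unitary twist `|det|^{κ/4}`**, and
`χ(det a) = a^{κ}` on `A_G`. [cite: BorelJacquetCorvallis1979, 5.7] [cite: Clozel1990, §3.3] -/
theorem exists_unitaryTwist (h2 : Module.finrank ℚ K = 2) {hcpt : isCompact_glFiniteIntegralLevel 2 K}
    (π : CuspidalAutomorphicRepData 2 K hcpt) (hW' : π.1.W' = ⊥)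
    {lam : (K →+* ℂ) → Fin 2 → ℤ} (hdom : ∀ τ, Weight.IsDominant (lam τ))
    {T : InfinityType K 2} (hT : π.1.HasInfinityType T)
    (hTa : ∀ τ : K →+* ℂ, (T τ).map ArchWeight.a = (cohomologicalInfinityType 2 K (Weight.dual (lam τ)) τ).map ArchWeight.a) :
    ∃ Tw : UnitaryTwist π.1, ∀ t : ℝ≥0ˣ,
      ((detTwist 2 Tw.χ (posRealScalar 2 K t) : ℂˣ) : ℂ) = (((t : ℝ≥0) : ℝ) : ℂ) ^ FamilyData.centralExp lam := by
  set s : ℂ := (FamilyData.centralExp lam : ℂ) / 4 with hs_def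
  obtain ⟨χ, hχ⟩ := exists_heckeCharacter_ideleNorm_cpow (K := K) s
  have hcusp : ∀ φ ∈ π.1.W, mulChar (detTwist 2 χ) φ ∈ cuspFormsGL 2 K hcpt := fun φ hφ =>
    map_mulChar_detTwist_le_cuspFormsGL_of_cpow hχ π.2 ⟨φ, hφ, rfl⟩
  have hs : s * (2 * Module.finrank ℚ K : ℕ) = -(∑ σ : K →+* ℂ, ((T σ).map ArchWeight.a).sum) := by
    rw [sum_sum_a_eq_neg_centralExp hdom hTa, neg_neg, h2, hs_def]
    push_cast; ring
  refine ⟨⟨χ, s, hχ, hcusp, fun φ hφ => ?_⟩, fun t => ?_⟩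
  · refine (AdelicGroupData.gl 2 K).leftInvariant_quotientSubgroup
      (isLeftInvariant_of_mem_automorphicForms (cuspFormsGL_le_automorphicForms 2 K hcpt (hcusp φ hφ))) ?_
    rintro _ ⟨t, rfl⟩ g
    exact mulChar_detTwist_apply_posRealScalar_mul_of_cpow hχ hs
      (fun t g => hT.apply_posRealScalar_mul_of_W'_eq_bot hW' hφ t g) t g
  · have ht : (0 : ℝ) < ((t : ℝ≥0) : ℝ) := NNReal.coe_pos.2 (pos_iff_ne_zero.2 t.ne_zero)
    change ((detTwist 2 χ (posRealScalar 2 K t) : ℂˣ) : ℂ) = _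
    rw [detTwist_posRealScalar_of_cpow hχ t, h2, hs_def]
    exact ofReal_pow_four_cpow ht _

/-! ### No archimedean unipotent invariants -/

/-- **A cusp form killed by the six operators vanishes** (`K` imaginary quadratic).
[cite: Harder1987, §3.1] [cite: MoeglinWaldspurger1995, Lemma I.2.10] -/
theorem noinv [IsTotallyComplex K] (h2 : Module.finrank ℚ K = 2) {hcpt : isCompact_glFiniteIntegralLevel 2 K}
    (π : CuspidalAutomorphicRepData 2 K hcpt) (hW' : π.1.W' = ⊥)
    {ρ𝔤 : (AutomorphyDatum.gl 2 K hcpt).arch.lie →ₗ⁅ℝ⁆ Module.End ℂ π.1.Quot} (hρ : π.1.HasLieAction ρ𝔤)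
    (v : π.1.W) (h1 : (opsW π.1 hW' ρ𝔤).LE v = 0) (h2' : (opsW π.1 hW' ρ𝔤).LF v = 0) (h3 : (opsW π.1 hW' ρ𝔤).LH v = 0)
    (h4 : (opsW π.1 hW' ρ𝔤).RE v = 0) (h5 : (opsW π.1 hW' ρ𝔤).RF v = 0) (h6 : (opsW π.1 hW' ρ𝔤).RH v = 0) :
    v = 0 := by
  have hK : Subsingleton (InfinitePlace K) := subsingleton_infinitePlace K h2
  have h0 := GL2ArchUnipotent.eq_zero_of_lieDeriv_placeLie_eq_zero hK (π.2 v.2) fun Y hY =>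
    lieDeriv_placeLie_eq_zero_of_killed π.1 hW' hρ h1 h2' h3 h4 h5 h6 hY
  exact Subtype.ext h0

/-! ### Conjugation of `i · 1` -/

/-- `\overline{i · 1} = −i · 1`. [folklore] -/
theorem conj_map_I_smul_one :
    ((I • (1 : Matrix (Fin 2) (Fin 2) ℂ)).map (starRingEnd ℂ)) = (-I) • (1 : Matrix (Fin 2) (Fin 2) ℂ) := by
  ext i j
  by_cases h : i = j
  · subst h; simp
  · simp [Matrix.one_apply_ne h]

/-- `\overline{1} = 1`. [folklore] -/
theorem conj_map_one : ((1 : Matrix (Fin 2) (Fin 2) ℂ).map (starRingEnd ℂ)) = 1 :=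
  Matrix.map_one _ (map_zero _) (map_one _)

/-! ### The scalars of the centre of `𝔤𝔩₂(K_{w₀})` on `W` and on `E_λ(ℂ)` -/

/-- **The centre `1, i·1 ∈ 𝔤𝔩₂(K_{w₀})` acts on `W` by `−κ_{σ₀} − κ_{σ̄₀}`, `i(κ_{σ̄₀} − κ_{σ₀})`**
(`κ_τ = λ_{τ,0} + λ_{τ,1}`), through the Harish-Chandra parameter. [cite: Knapp2002, Thm. 5.44]
[cite: Clozel1990, §3.3] -/
theorem center_scalars_W [IsTotallyComplex K] {hcpt : isCompact_glFiniteIntegralLevel 2 K}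
    (π : AutomorphicRepData (AutomorphyDatum.gl 2 K hcpt)) (hW' : π.W' = ⊥)
    {ρ𝔤 : (AutomorphyDatum.gl 2 K hcpt).arch.lie →ₗ⁅ℝ⁆ Module.End ℂ π.Quot}
    {lam : (K →+* ℂ) → Fin 2 → ℤ} {T : InfinityType K 2}
    (hχ : Literature.NumberTheory.Automorphic.HasArchParameter
      (ρ𝔤.comp (LieSubalgebra.topEquiv :
        (⊤ : LieSubalgebra ℝ (Matrix (Fin 2) (Fin 2) (mixedSpace K))) ≃ₗ⁅ℝ⁆
          Matrix (Fin 2) (Fin 2) (mixedSpace K)).symm.toLieHom) fun σ => (T σ).map ArchWeight.a)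
    (hTa : ∀ τ : K →+* ℂ, (T τ).map ArchWeight.a = (cohomologicalInfinityType 2 K (Weight.dual (lam τ)) τ).map ArchWeight.a) :
    (∀ φ : π.W, rhoAt (π.lieOnW hW' ρ𝔤) (complexPlace K) 1 φ =
        (-((lam σ₀ 0 : ℂ) + lam σ₀ 1) - ((lam (ComplexEmbedding.conjugate σ₀) 0 : ℂ) + lam (ComplexEmbedding.conjugate σ₀) 1)) • φ) ∧
    (∀ φ : π.W, rhoAt (π.lieOnW hW' ρ𝔤) (complexPlace K) (I • 1) φ =
        (I * (-((lam σ₀ 0 : ℂ) + lam σ₀ 1)) - I * (-((lam (ComplexEmbedding.conjugate σ₀) 0 : ℂ) + lam (ComplexEmbedding.conjugate σ₀) 1))) • φ) := by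
  have hHC := π.hasHCParameter_rhoAt hW' hχ (complexPlace K)
  have hid : ((AlgHom.id ℝ ℂ : ℂ →ₐ[ℝ] ℂ).toRingHom.comp (complexPlace K).1.embedding) = (σ₀ : K →+* ℂ) :=
    RingHom.ext fun x => rfl
  have hconj : ((Complex.conjAe : ℂ →ₐ[ℝ] ℂ).toRingHom.comp (complexPlace K).1.embedding) =
      ComplexEmbedding.conjugate (σ₀ : K →+* ℂ) := RingHom.ext fun x => rfl
  have hs : (fun τ : ℂ →ₐ[ℝ] ℂ => (T (τ.toRingHom.comp (complexPlace K).1.embedding)).map ArchWeight.a)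
      (AlgHom.id ℝ ℂ) = {-(lam σ₀ 1 : ℂ) + 2⁻¹, -(lam σ₀ 0 : ℂ) - 2⁻¹} := by
    simp only [hid, hTa, cohomological_map_a]
  have ht : (fun τ : ℂ →ₐ[ℝ] ℂ => (T (τ.toRingHom.comp (complexPlace K).1.embedding)).map ArchWeight.a)
      (Complex.conjAe : ℂ →ₐ[ℝ] ℂ) =
      {-(lam (ComplexEmbedding.conjugate σ₀) 1 : ℂ) + 2⁻¹, -(lam (ComplexEmbedding.conjugate σ₀) 0 : ℂ) - 2⁻¹} := by
    simp only [hconj, hTa, cohomological_map_a]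
  set ρW := rhoAt (π.lieOnW hW' ρ𝔤) (complexPlace K) with hρW
  obtain ⟨⟨hp, hm⟩, -⟩ := scalars_of_hasHCParameter ρW hHC hs ht
  refine ⟨fun φ => ?_, fun φ => ?_⟩
  · have e := rho_eq_add ρW (1 : Matrix (Fin 2) (Fin 2) ℂ)
    rw [conj_map_one, hp, hm] at e
    rw [e, LinearMap.add_apply, LinearMap.smul_apply, LinearMap.smul_apply, Module.End.one_apply, ← add_smul]
    congr 1; ring
  · have e := rho_eq_add ρW (I • (1 : Matrix (Fin 2) (Fin 2) ℂ))
    have hI1 : (ofRho ρW).toFun (AlgHom.id ℝ ℂ) (I • 1) = I • (ofRho ρW).toFun (AlgHom.id ℝ ℂ) 1 := by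
      have := ((ofRho ρW).toFun (AlgHom.id ℝ ℂ)).toLinearMap.map_smul I 1
      simpa only [LieHom.coe_toLinearMap] using this
    have hI2 : (ofRho ρW).toFun (Complex.conjAe : ℂ →ₐ[ℝ] ℂ) ((-I) • 1) =
        (-I) • (ofRho ρW).toFun (Complex.conjAe : ℂ →ₐ[ℝ] ℂ) 1 := by
      have := ((ofRho ρW).toFun (Complex.conjAe : ℂ →ₐ[ℝ] ℂ)).toLinearMap.map_smul (-I) 1
      simpa only [LieHom.coe_toLinearMap] using this
    rw [conj_map_I_smul_one, hI1, hI2, hp, hm] at e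
    rw [e, LinearMap.add_apply, LinearMap.smul_apply, LinearMap.smul_apply, LinearMap.smul_apply, LinearMap.smul_apply,
      Module.End.one_apply, smul_smul, smul_smul, ← add_smul]
    congr 1; ring

/-- The scalar of `u · 1` in the slot `τ`: `A_τ(u·1) = u (λ_{τ,0} + λ_{τ,1})`. [folklore] -/
theorem algLie_smul_one_eq [IsTotallyComplex K] {lam : (K →+* ℂ) → Fin 2 → ℤ} (hdom : ∀ τ, Weight.IsDominant (lam τ))
    (τ : K →+* ℂ) (u : ℂ) :
    algLie 2 (lam τ) (complexPlace K) (u • (1 : Matrix (Fin 2) (Fin 2) ℂ)) =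
      (u * ((lam τ 0 : ℂ) + lam τ 1)) • (1 : Module.End ℂ (GLnCohomology.CoeffModule ℂ 2 (lam τ))) := by
  have hc : ((coeffDegree (lam τ) : ℂ) + 2 * (lowestEntry (lam τ) : ℂ)) = (lam τ 0 : ℂ) + lam τ 1 := by
    have h1 : ((coeffDegree (lam τ) : ℕ) : ℂ) = ((lam τ 0 - lam τ 1 : ℤ) : ℂ) := by
      rw [← coeffDegree_two_cast (lam τ) (hdom τ)]; norm_cast
    rw [h1, lowestEntry_two]; push_cast; ring
  rw [algLie_smul_one, Nat.cast_ofNat, hc]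

/-- `dE_λ(φ_{w₀} 1) = (κ_{σ₀} + κ_{σ̄₀}) · 1` on the honest tensor product. [cite: FultonHarrisGTM129, §15.5] -/
theorem coeffPlaceLieT_one [IsTotallyComplex K] (lam : (K →+* ℂ) → Fin 2 → ℤ) (hdom : ∀ τ, Weight.IsDominant (lam τ)) :
    coeffPlaceLieT K lam (complexPlace K) 1 =
      (((lam (complexPlace K).1.embedding 0 : ℂ) + lam (complexPlace K).1.embedding 1) +
        ((lam (ComplexEmbedding.conjugate (complexPlace K).1.embedding) 0 : ℂ) +
          lam (ComplexEmbedding.conjugate (complexPlace K).1.embedding) 1)) • (1 : Module.End ℂ _) := by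
  rw [coeffPlaceLieT_apply, conj_map_one,
    show (1 : Matrix (Fin 2) (Fin 2) ℂ) = (1 : ℂ) • (1 : Matrix (Fin 2) (Fin 2) ℂ) from (one_smul _ _).symm,
    algLie_smul_one_eq hdom, algLie_smul_one_eq hdom, one_mul, one_mul, PiTensor.slot_smul, PiTensor.slot_smul,
    slot_one', slot_one', ← add_smul]

/-- `dE_λ(φ_{w₀} (i·1)) = i(κ_{σ₀} − κ_{σ̄₀}) · 1` on the honest tensor product. [cite: FultonHarrisGTM129, §15.5] -/
theorem coeffPlaceLieT_I_one [IsTotallyComplex K] (lam : (K →+* ℂ) → Fin 2 → ℤ) (hdom : ∀ τ, Weight.IsDominant (lam τ)) :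
    coeffPlaceLieT K lam (complexPlace K) (I • 1) =
      (I * ((lam (complexPlace K).1.embedding 0 : ℂ) + lam (complexPlace K).1.embedding 1) -
        I * ((lam (ComplexEmbedding.conjugate (complexPlace K).1.embedding) 0 : ℂ) +
          lam (ComplexEmbedding.conjugate (complexPlace K).1.embedding) 1)) • (1 : Module.End ℂ _) := by
  rw [coeffPlaceLieT_apply, conj_map_I_smul_one, algLie_smul_one_eq hdom, algLie_smul_one_eq hdom,
    PiTensor.slot_smul, PiTensor.slot_smul, slot_one', slot_one', ← add_smul]
  congr 1
  ring

/-- **The centre `1, i·1` acts on `E_λ(ℂ)` by `κ_{σ₀} + κ_{σ̄₀}`, `i(κ_{σ₀} − κ_{σ̄₀})`.**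
[cite: FultonHarrisGTM129, §15.5] -/
theorem center_scalars_E [IsTotallyComplex K] (lam : (K →+* ℂ) → Fin 2 → ℤ) (hdom : ∀ τ, Weight.IsDominant (lam τ)) :
    (∀ v, coeffPlaceLie K lam (complexPlace K) 1 v =
        (((lam σ₀ 0 : ℂ) + lam σ₀ 1) + ((lam (ComplexEmbedding.conjugate σ₀) 0 : ℂ) + lam (ComplexEmbedding.conjugate σ₀) 1)) • v) ∧
    (∀ v, coeffPlaceLie K lam (complexPlace K) (I • 1) v =
        (I * ((lam σ₀ 0 : ℂ) + lam σ₀ 1) - I * ((lam (ComplexEmbedding.conjugate σ₀) 0 : ℂ) + lam (ComplexEmbedding.conjugate σ₀) 1)) • v) := by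
  refine ⟨fun v => ?_, fun v => ?_⟩
  · have h := LinearMap.congr_fun (coeffPlaceLieT_one lam hdom) v
    exact h
  · have h := LinearMap.congr_fun (coeffPlaceLieT_I_one lam hdom) v
    exact h

/-! ### The level is preserved by the `𝔨`-operators -/

/-- `E_k, F_k, H_k` of `opsW` preserve the `K(𝔫)`-fixed forms. [folklore] -/
theorem kOps_preserve_levelFixed [IsTotallyComplex K] {hcpt : isCompact_glFiniteIntegralLevel 2 K}
    (π : AutomorphicRepData (AutomorphyDatum.gl 2 K hcpt)) (hW' : π.W' = ⊥)
    {ρ𝔤 : (AutomorphyDatum.gl 2 K hcpt).arch.lie →ₗ⁅ℝ⁆ Module.End ℂ π.Quot} (hρ : π.HasLieAction ρ𝔤)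
    {𝔫 : Ideal (𝓞 K)} (h𝔫 : 𝔫 ≠ 0) :
    (∀ x ∈ GL2CCuspForm.levelFixed π 𝔫, (opsW π hW' ρ𝔤).Ek x ∈ GL2CCuspForm.levelFixed π 𝔫) ∧
    (∀ x ∈ GL2CCuspForm.levelFixed π 𝔫, (opsW π hW' ρ𝔤).Fk x ∈ GL2CCuspForm.levelFixed π 𝔫) ∧
    (∀ x ∈ GL2CCuspForm.levelFixed π 𝔫, (opsW π hW' ρ𝔤).Hk x ∈ GL2CCuspForm.levelFixed π 𝔫) := by
  have hP := preserves_levelFixed π hW' hρ h𝔫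
  refine ⟨fun x hx => ?_, fun x hx => ?_, fun x hx => ?_⟩
  · rw [Ops.Ek_apply]; exact Submodule.sub_mem _ (hP.le x hx) (hP.rf x hx)
  · rw [Ops.Fk_apply]; exact Submodule.sub_mem _ (hP.lf x hx) (hP.re x hx)
  · rw [Ops.Hk_apply]; exact Submodule.sub_mem _ (hP.lh x hx) (hP.rh x hx)

/-! ### The eigenclass -/

-- The assembly elaborates a `FamilyData` literal with a dozen dependent fields and unifies it with the
-- lemmas of `GL2CESHNonvanishing` / `GL2CESHHecke`; as in `AutomorphicCohomologyGLnCoeffHecke`.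
set_option maxHeartbeats 800000 in
/-- **The Eichler–Shimura–Harder eigenclass of a clean Bianchi cusp form** (hypothesis `h2c` of
`bianchi_cuspidal_regularLAlgebraic_eigenclassExists_of_cleanResGLTwo'`): for `K` imaginary
quadratic, `π = W / 0` clean cuspidal of `GL₂(𝔸_K)` whose infinity type has the `a`-exponents of
the cohomological type of the dual weights `λ_τ^∨` (`λ_τ` dominant), `𝔫 ≠ 0` and a non-zero
`K(𝔫)`-fixed `φ ∈ W`, there is a non-zero class `x ∈ H¹(S_{K_f(𝔫)}, E_λ(ℂ))` with
`T_{v,i} x = q_v^{i(2−i)/2} e_i(α_v) x` for all `v ∤ 𝔫`, all Satake parameters `α_v` of `π` at `v`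
and `i ≤ 2` — the van Est class of the Eichler–Shimura–Harder family of `π`.
[cite: Harder1987, §3] [cite: Scholze2015, §V.4, proof of Cor. V.4.2] [cite: Borel1997, 11.12] -/
theorem cleanResGLTwo_eigenclass (K : Type) [Field K] [NumberField K] (htc : IsTotallyComplex K)
    (h2 : Module.finrank ℚ K = 2) (hcpt : isCompact_glFiniteIntegralLevel 2 K)
    (𝔫 : Ideal (𝓞 K)) (lam : (K →+* ℂ) → Fin 2 → ℤ) (h𝔫 : 𝔫 ≠ 0) (hdom : ∀ τ, Weight.IsDominant (lam τ))
    (π : CuspidalAutomorphicRepData 2 K hcpt) (hW' : π.1.W' = ⊥)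
    (T : InfinityType K 2) (hT : π.1.HasInfinityType T)
    (hTa : ∀ τ : K →+* ℂ, (T τ).map ArchWeight.a = (cohomologicalInfinityType 2 K (Weight.dual (lam τ)) τ).map ArchWeight.a)
    (φ : (AdelicGroupData.gl 2 K).Adelic → ℂ) (hφW : φ ∈ π.1.W) (hφ0 : φ ≠ 0)
    (hfix : ∀ u ∈ principalCongruenceLevel 2 K 𝔫, rightTranslation (AdelicGroupData.gl 2 K) u φ = φ) :
    ∃ (q : ℕ) (x : ResGLnCohomology.levelCohomology ℂ 2 K 𝔫 lam q), x ≠ 0 ∧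
      ∀ v : HeightOneSpectrum (𝓞 K), ¬ v.asIdeal ∣ 𝔫 → ∀ α : Multiset ℂ,
        π.1.HasSatakeParamAt v α → ∀ i ≤ 2,
          ResGLnCohomology.heckeT ℂ 2 K 𝔫 lam q v i x = heckeEigenvalueOf 2 v α i • x := by
  haveI := htc
  have hK : Subsingleton (InfinitePlace K) := subsingleton_infinitePlace K h2
  obtain ⟨-, ρ𝔤, hρ, hχ⟩ := id hT
  -- an automorphic measure and the unitary twist
  obtain ⟨μA, hμA⟩ := AdelicGroupData.exists_isAutomorphicMeasure_gl_holds (n := 2) (K := K)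
  haveI := hμA
  obtain ⟨Tw, hχκ⟩ := exists_unitaryTwist h2 π hW' hdom hT hTa
  -- the lowest `K`-type in the level
  have hv𝔫 : (⟨φ, hφW⟩ : π.1.W) ∈ GL2CCuspForm.levelFixed π.1 𝔫 := hfix
  have hv0 : (⟨φ, hφW⟩ : π.1.W) ≠ 0 := fun h0 => hφ0 (congrArg Subtype.val h0)
  obtain ⟨hcL, hcR, w, hw𝔫, hw0, hw⟩ := exists_lowestKType_mem_of_noinv π.1 hW' hρ hχ hTa hdom Tw μA
    (fun v h1 h2' h3 h4 h5 h6 => noinv h2 π hW' hρ v h1 h2' h3 h4 h5 h6) h𝔫 hv𝔫 hv0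
  set d : ℕ := (lam σ₀ 0 - lam σ₀ 1).toNat with hd
  -- `d_{σ̄₀} = d_{σ₀}` (both Casimir scalars are `½ d(d+2)` on the non-zero `w`)
  set d' : ℕ := (lam (ComplexEmbedding.conjugate σ₀) 0 - lam (ComplexEmbedding.conjugate σ₀) 1).toNat with hd'
  have hdd : d' = d := by
    obtain ⟨-, hR'⟩ := casL_casR_opsW_nat π.1 hW' hχ hTa hdom
    have e := smul_left_injective ℂ hw0 ((hcR w).symm.trans (hR' w))
    rw [half_mul_eq_ofReal, half_mul_eq_ofReal] at e
    exact (eq_of_mul_add_two_eq (Complex.ofReal_injective e)).symm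
  -- the coordinate model of `E_λ(ℂ)`
  obtain ⟨Θ, hΘ6⟩ := GL2CCoeff.exists_coeffModelEquiv K hK lam (hdom _) (hdom _) rfl hdd
  have hΘ := Ops.intertwines_of_equiv hΘ6
  -- the cochain of the model
  set O := opsW π.1 hW' ρ𝔤 with hO_def
  have hO := isLawful_opsW π.1 hW' ρ𝔤
  have hip := Tw.isPosForm_pet μA
  obtain ⟨hE, hF, hH⟩ := opsW_adjoint π.1 hW' hρ Tw μA
  obtain ⟨hES, hFS, hHS⟩ := kOps_preserve_levelFixed π.1 hW' hρ h𝔫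
  obtain ⟨S, hwS, hSfd, hES', hFS', hHS'⟩ := kFinite_opsW π.1 hW' hρ w
  haveI := hSfd
  have hmodel := eshCochain_model d hO hcL hcR hip hE hF hH hES' hFS' hHS' hwS hw0 hw
  obtain ⟨hne, hcoch, hclosed, hδ⟩ := hmodel
  set η : Fin 3 → model π.1.W d := eshCochain ((aut O d).add (coeff (C := π.1.W) d)) (yVec O d w) with hη_def
  -- the entries of `η` are `K(𝔫)`-fixed
  have hyL : yVec O d w ∈ valuesIn d (GL2CCuspForm.levelFixed π.1 𝔫) := yVec_mem_valuesIn O d hFS hw𝔫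
  obtain ⟨-, hFv, -⟩ := valuesIn_stable O d hES hFS hHS
  set L := GL2CCuspForm.levelFixed π.1 𝔫 with hL_def
  set O' := (aut O d).add (coeff (C := π.1.W) d) with hO'_def
  have hF1 : O'.Fk (yVec O d w) ∈ valuesIn d L := hFv _ hyL
  have hF2 : O'.Fk (O'.Fk (yVec O d w)) ∈ valuesIn d L := hFv _ hF1
  have hye := (mem_valuesIn d).1 hyL
  have hF1e := (mem_valuesIn d).1 hF1
  have hF2e := (mem_valuesIn d).1 hF2
  have hfixη : ∀ i l m, ((η i : ℕ → ℕ → π.1.W) l m) ∈ GL2CCuspForm.levelFixed π.1 𝔫 := by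
    intro i l m
    fin_cases i
    · change (((eshCochain O' (yVec O d w) 0 : model π.1.W d)) : ℕ → ℕ → π.1.W) l m ∈ L
      rw [eshCochain_zero, Submodule.coe_neg, Pi.neg_apply, Pi.neg_apply]
      exact Submodule.neg_mem _ (hF1e l m)
    · change (((eshCochain O' (yVec O d w) 1 : model π.1.W d)) : ℕ → ℕ → π.1.W) l m ∈ L
      rw [eshCochain_one, Submodule.coe_sub, Submodule.coe_smul, Pi.sub_apply, Pi.sub_apply, Pi.smul_apply, Pi.smul_apply]
      exact Submodule.sub_mem _ (hye l m) (Submodule.smul_mem _ _ (hF2e l m))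
    · change (((eshCochain O' (yVec O d w) 2 : model π.1.W d)) : ℕ → ℕ → π.1.W) l m ∈ L
      rw [eshCochain_two, Submodule.coe_smul, Submodule.coe_add, Submodule.coe_smul, Pi.smul_apply, Pi.smul_apply,
        Pi.add_apply, Pi.add_apply, Pi.smul_apply, Pi.smul_apply]
      exact Submodule.smul_mem _ _ (Submodule.add_mem _ (hye l m) (Submodule.smul_mem _ _ (hF2e l m)))
  -- the scalars of the centre
  obtain ⟨hμ₁, hν₁⟩ := center_scalars_W π.1 hW' hχ hTa
  obtain ⟨hμ₂, hν₂⟩ := center_scalars_E lam hdom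
  -- the family data
  let D : FamilyData K hcpt :=
    { π := π.1, h := hW', ρ𝔤 := ρ𝔤, hρ := hρ, lam := lam, d := d, Θ := Θ, hΘ := hΘ, 𝔫 := 𝔫, h𝔫 := h𝔫, η := η,
      hfix := hfixη, hcoch := hcoch, hclosed := hclosed,
      μ₁ := -((lam σ₀ 0 : ℂ) + lam σ₀ 1) - ((lam (ComplexEmbedding.conjugate σ₀) 0 : ℂ) + lam (ComplexEmbedding.conjugate σ₀) 1),
      hμ₁ := hμ₁,
      hμ₂ := fun v => by rw [hμ₂ v]; congr 1; ring,
      ν₁ := I * (-((lam σ₀ 0 : ℂ) + lam σ₀ 1)) - I * (-((lam (ComplexEmbedding.conjugate σ₀) 0 : ℂ) + lam (ComplexEmbedding.conjugate σ₀) 1)),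
      hν₁ := hν₁,
      hν₂ := fun v => by rw [hν₂ v]; congr 1; ring }
  have hδ' : D.setup.deltaOne D.η = 0 := hδ
  have hne' : D.η 0 ≠ 0 := hne
  refine ⟨1, GL2C.vanEstClass (D.isAutomorphicFamily h2), D.vanEstClass_ne_zero h2 Tw μA hχκ hδ' hne', ?_⟩
  intro v hv α hα i hi
  exact D.heckeT_vanEstClass h2 hv hα hi

end GL2CESH

end Literature.NumberTheory.Automorphic

end
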